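/-
Origin: expansion seat `planner-pub-hodgecm-pv10-0`, handover #23 2026-08-18T05:52:55Z (`HOME/pub-hodgecm-pv10/lean/Pv10/IdeleBoxes.lean`, md5 3377a995, 97 lines);
landed by the gen-6 packager in gate run 24 as `HodgeCM/PerL34/IdeleBoxes.lean` (import ^import Pv[0-9]+\.→import HodgeCM.PerL34. ×1).
-/
/-
# Compact idele boxes `S · ∏_v 𝒪_v^×` and the shape of the classical proof that `C¹_K` is compact

WIP module `Pv10.IdeleBoxes` (pub-hodgecm-pv10); intended landing `HodgeCM/PerL34/IdeleBoxes.lean`.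

Sequel to `NormOneCompactCriterion.lean` (node N15, the one print input `NormOneIdeleClassesCompact`
of PerL v5 tex l. 311).  Kernel facts, Mathlib only:

* `∏_v 𝒪_v` and its unit group `∏_v 𝒪_v^×` are COMPACT (Tychonoff over the compactness of every
  `𝒪_v`, which is kernel since `ResidueFieldsFinite.lean`, and Mathlib's `CompactSpace αˣ` for compact
  `T₁` monoids);
* the unit-box map `K_∞^× × ∏_v 𝒪_v^× → 𝔸_K^×` is continuous, so `S · ∏_v 𝒪_v^×` is a compact set of
  ideles for every compact `S ⊆ K_∞^×`, and so is any finite union of translates;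
* `normOneIdeleClassesCompact_of_boxes`: if finitely many translates `yᵢ · S · ∏_v 𝒪_v^×` meet
  `x · K^×` for every norm-one idele `x`, then `C¹_K` is compact.

This is the SHAPE of the classical argument (Cassels–Fröhlich II §16–17, PDF pp. 121–123: the box `W`;
equivalently finiteness of the class number — the translates `yᵢ` — plus the unit theorem — the
archimedean box `S`).  What remains print (typed in `NormOneCompactCriterion.lean` as
`NormOneIdeleCompactCover`, NOT asserted anywhere) is the existence of such `S`, `(yᵢ)`.
-/
import Summits.HodgeConjecture.HodgeCM.PerL34.NormOneCompactCriterion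

set_option autoImplicit false

noncomputable section

open Topology Filter Set Function Pointwise

namespace NumberField

open IsDedekindDomain

variable (K : Type*) [Field K] [NumberField K]

/-! ## `∏_v 𝒪_v` and `∏_v 𝒪_v^×` are compact -/

/-- (Ported verbatim from the HodgeCMPerL package; no docstring in the source.) -/
instance compactSpace_integralAdeles : CompactSpace (integralAdeles K) :=
  inferInstanceAs (CompactSpace (Π v : HeightOneSpectrum (𝓞 K), v.adicCompletionIntegers K))

/-- (Ported verbatim from the HodgeCMPerL package; no docstring in the source.) -/
instance compactSpace_integralAdeles_units : CompactSpace (integralAdeles K)ˣ := inferInstance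

/-! ## The unit box `K_∞^× × ∏_v 𝒪_v^× → 𝔸_K^×` -/

/-- `(a, u) ↦ a_∞ · u_f : K_∞^× × ∏_v 𝒪_v^× →* 𝔸_K^×`. -/
def unitBox : (InfiniteAdeleRing K)ˣ × (integralAdeles K)ˣ →* ideleGroup K :=
  (infUnitsToIdele K).coprod (intUnitsToIdele K)

/-- (Ported verbatim from the HodgeCMPerL package; no docstring in the source.) -/
theorem unitBox_apply (p : (InfiniteAdeleRing K)ˣ × (integralAdeles K)ˣ) :
    unitBox K p = infUnitsToIdele K p.1 * intUnitsToIdele K p.2 := rfl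

/-- (Ported verbatim from the HodgeCMPerL package; no docstring in the source.) -/
theorem continuous_unitBox : Continuous (unitBox K) :=
  ((continuous_infUnitsToIdele K).comp continuous_fst).mul
    ((continuous_intUnitsToIdele K).comp continuous_snd)

/-- `S · ∏_v 𝒪_v^×` is compact for compact `S ⊆ K_∞^×`. -/
theorem isCompact_unitBox_image {S : Set (InfiniteAdeleRing K)ˣ} (hS : IsCompact S) :
    IsCompact (unitBox K '' (S ×ˢ (univ : Set (integralAdeles K)ˣ))) :=
  (hS.prod isCompact_univ).image (continuous_unitBox K)

/-- A finite union of translates `yᵢ · S · ∏_v 𝒪_v^×` is compact. -/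
theorem isCompact_biUnion_smul_unitBox_image {S : Set (InfiniteAdeleRing K)ˣ} (hS : IsCompact S)
    (F : Finset (ideleGroup K)) :
    IsCompact (⋃ y ∈ F, y • unitBox K '' (S ×ˢ (univ : Set (integralAdeles K)ˣ))) :=
  F.isCompact_biUnion fun y _ => (isCompact_unitBox_image K hS).smul y

/-- The unit box lies in the norm-one ideles iff its archimedean part has norm one. -/
theorem unitBox_mem_normOneIdeles_iff (a : (InfiniteAdeleRing K)ˣ) (u : (integralAdeles K)ˣ) :
    unitBox K (a, u) ∈ normOneIdeles K ↔ ‖(a : InfiniteAdeleRing K)‖ = 1 := by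
  rw [mem_normOneIdeles_iff, unitBox_apply, map_mul, ideleNorm_infUnitsToIdele,
    ideleNorm_intUnitsToIdele, mul_one]

/-! ## The shape of the classical proof -/

/-- **If finitely many translates of a compact archimedean box times `∏_v 𝒪_v^×` meet `x · K^×` for
every norm-one idele `x`, then `C¹_K` is compact.**  (Class-number finiteness supplies the
translates, the unit theorem / Minkowski the box: C–F II §§16–17.) -/
theorem normOneIdeleCompactCover_of_boxes {S : Set (InfiniteAdeleRing K)ˣ} (hS : IsCompact S)
    (F : Finset (ideleGroup K))
    (hcover : ∀ x ∈ normOneIdeles K, ∃ k ∈ principalIdeles K, ∃ y ∈ F,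
      x * k ∈ y • unitBox K '' (S ×ˢ (univ : Set (integralAdeles K)ˣ))) :
    NormOneIdeleCompactCover K := by
  refine ⟨⋃ y ∈ F, y • unitBox K '' (S ×ˢ (univ : Set (integralAdeles K)ˣ)),
    isCompact_biUnion_smul_unitBox_image K hS F, fun x hx => ?_⟩
  obtain ⟨k, hk, y, hy, hmem⟩ := hcover x hx
  exact ⟨k, hk, mem_iUnion₂.mpr ⟨y, hy, hmem⟩⟩

/-- (Ported verbatim from the HodgeCMPerL package; no docstring in the source.) -/
theorem normOneIdeleClassesCompact_of_boxes {S : Set (InfiniteAdeleRing K)ˣ} (hS : IsCompact S)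
    (F : Finset (ideleGroup K))
    (hcover : ∀ x ∈ normOneIdeles K, ∃ k ∈ principalIdeles K, ∃ y ∈ F,
      x * k ∈ y • unitBox K '' (S ×ˢ (univ : Set (integralAdeles K)ˣ))) :
    NormOneIdeleClassesCompact K :=
  normOneIdeleClassesCompact_of_cover K (normOneIdeleCompactCover_of_boxes K hS F hcover)

end NumberField

end
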